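import Summits.QuantumFields.BalabanUV.Beta.D1BFx.GluonNeedleGlueT12
import Summits.QuantumFields.BalabanUV.Beta.D1BFx.GluonLocalProjRow
import Summits.QuantumFields.BalabanUV.Beta.D1BFx.GluonLocalNdlRow
import Summits.QuantumFields.BalabanUV.Beta.D1BFx.GluonLocalDipRow
import Summits.QuantumFields.BalabanUV.Beta.D1BFx.GluonProjLocalRow
import Summits.QuantumFields.BalabanUV.Beta.D1BFx.GluonNdlLocalRow
import Summits.QuantumFields.BalabanUV.Beta.D1BFx.GluonDipLocalRow

/-!
# `BalabanUV.Beta.D1BFx.GluonNeedleRowsT12` — road «BF-x» for binder row D1, slot (K), END row `hGrp gN`, «GN-WIRE» PART 1: THE GLUON NEEDLE TABLE ROWS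
# T₁ (`SbT ⊗ SbRc`) AND T₂ (`SbRc ⊗ SbT`) OF `NeedleRowGlue.abs_gN_row_le_of_tables` AT THE RAY OF RECORD — `h₁` from the three LANDED pieces
# (`GluonLocalDipRow` leaf-03-g13, `GluonLocalNdlRow` leaf-01, `GluonLocalProjRow` owner), `h₂` from the two landed pieces (`GluonNdlLocalRow` leaf-01,
# `GluonProjLocalRow` owner) and ONE displayed cell hypothesis (T₂-K, `dip ⊗ SbT`, not yet in the tree), modulo [B5, Prop. 1.2] ∧ [B5, (1.126)–(1.127)] BY NAME,
# the END's pins `hlam`, `cE = n⁴`, `cR = −cE`, and the ray `cK n = cgh n·n²`, `cQ n = cgh n·a` with the DISPLAYED scalar letter `|cgh n| ≤ cgh₀` (P13)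

HONEST DEPENDENCY (cell records, verbatim): «continuum YM on T⁴ ⇐ BetaPertH ∧ nine spine estimates (0/9 proved); BetaPertH ⇐ (D1) ∧ (D4) ∧
CAP+tail; G-an2-4 gates asym, D1 and NE2/3/4.»  HONEST FRAMING (cell contract, verbatim): «discharging `BetaPertH` makes Bałaban's UV stability
UNCONDITIONAL — a real constructive-QFT result; it is NOT the continuum limit and NOT the Clay problem.»  THIS MODULE DISCHARGES NOTHING of the
wall: [folklore] wiring BY NAME — `GluonNeedleGlueT12.h₁_of_pieces ∕ h₂_of_pieces` (owner) fed with `GluonLocalDipRow.exists_locDip_row_le` (leaf-03-g13; at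
the CONSTANT auxiliary weight `cgh₀·n²`, then `|cK n| = |cgh n|·n² ≤ cgh₀·n²`), `GluonLocalNdlRow.exists_locNdl_row_le` ∕ `GluonNdlLocalRow.exists_ndlLoc_row_le`
(leaf-01; `cQ₀ := cgh₀·a`), `GluonLocalProjRow.exists_locProj_row_le` ∕ `GluonProjLocalRow.exists_projLoc_row_le` (owner), `GluonLegTails.spr_Ga_of_prop12`.
No `def`, no `def … : Prop`, nothing cited, 0 sorry; the printed statements enter as HYPOTHESES `h12`∕`h126`; the T₂-K cell is a HYPOTHESIS of `h₂_of_prop12`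
(in the auxiliary-weight form every announced cell shape instantiates).  P13 is LOAD-BEARING and displayed: the constants depend on `cgh₀`.  Root-level binders
hW ∕ hR-sockets ∕ hSX-socket ∕ D1Tel ∕ D1Rep — 0 discharged; (K) NOT closed; NOT D1, NOT `BetaPertH`, NOT continuum, NOT Clay.

ABSOLUTE RULE (cell charter, verbatim): «No internally-minted statement may enter as a cited fact. Every hypothesis is either kernel-proved in
this package or a verbatim quotation of a PUBLISHED theorem with page reference. The manuscript(s) under audit are NOT citable for their own
disputed steps — they are the thing under adjudication; programme-internal (2001/route/tribunal) claims are never citable.»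

CONTENT.
* §1 [folklore] `zero_le_cgh₀`, `abs_cQ_le`, `abs_weight_cell_le` (the true weight against the auxiliary constant weight: `|cK n·S| ≤ |cgh₀n²·S|`).
* §2 [folklore] **`h₁_of_prop12`** — `∃ C₁ ≥ 0, ∀ n ≥ 2, |ωgl n·cE n·Σ_b n⁻⁴·(n⁻⁸·fullSum(w ↦ w_μw_ν·biBubbleTable Ga Ga SbT SbRc μ ν (b+w) b))| ≤ C₁` (= `h₁` of
  `NeedleRowGlue.abs_gN_row_le_of_tables` with an existential constant), NO cell hypothesis.
* §3 [folklore] **`h₂_of_prop12`** — the same for T₂, modulo the displayed T₂-K cell `∃ C ≥ 0, ∀ n ≥ 1, |cgh₀·n²·cellSum n a (dipPiece n a) SbT μ ν| ≤ C`.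
* §4 (v1.1) [folklore] **`h₂_of_prop12'`** — T₂ with NO cell hypothesis (the T₂-K cell = leaf-03-g13's `GluonDipLocalRow.exists_dipLoc_row_le`, p275613).
NOT HERE (honest): T₃ (`h₃`, PART 2 `GluonNeedleRowT3`), T₈, the `hGrp` assembly (`RoadEndBFxRows.hGrp_of_rows`).
Unit `b2b-balaban-beta-d1-p2` (gen 11), road «BF-x» OWNER; `LEAVES-BFx.md` row (N) «GN-WIRE» PART 1.
-/

noncomputable section

namespace Summit.QuantumFields.BalabanUV.Beta.D1BFx.GluonNeedleRowsT12

open Finset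
open scoped BigOperators
open Literature.MathematicalPhysics.QuantumFieldTheory.Balaban1983to89
open Literature.MathematicalPhysics.QuantumFieldTheory.Balaban1983to89.Beta
open ExpKernelCalculus (Site MKer)
open DyadicShell (Pt toReal toReal_apply)
open WindowIdentification (fullSum)
open DressedMomentNormalisation (resSite)
open VectorTailsLoc (fam kfam)
open Summit.QuantumFields.BalabanUV.Beta.TameKernelCalculus (Spr)
open Summit.QuantumFields.BalabanUV.Beta.D1BFx.ReducedKernel (StencilR)
open Summit.QuantumFields.BalabanUV.Beta.D1BFx.FineHessianSectors (biBubbleTable)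
open Summit.QuantumFields.BalabanUV.Beta.D1BFx.GluonLeg (Ga)
open Summit.QuantumFields.BalabanUV.Beta.D1BFx.GluonLegTails (spr_Ga_of_prop12)
open Summit.QuantumFields.BalabanUV.Beta.D1BFx.FrozenLegTails (nOf MOf hn1)
open Summit.QuantumFields.BalabanUV.Beta.D1BFx.SectorRecut (SbT SbRc)
open Summit.QuantumFields.BalabanUV.Beta.D1BFx.GluonNeedleSplit (projPiece dipPiece ndlPiece)
open Summit.QuantumFields.BalabanUV.Beta.D1BFx.GluonNeedleGlue (cellSum)
open Summit.QuantumFields.BalabanUV.Beta.D1BFx.GluonNeedleGlueT12 (h₁_of_pieces h₂_of_pieces)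
open Summit.QuantumFields.BalabanUV.Beta.D1BFx.GluonLocalProjRow (exists_locProj_row_le)
open Summit.QuantumFields.BalabanUV.Beta.D1BFx.GluonLocalNdlRow (exists_locNdl_row_le)
open Summit.QuantumFields.BalabanUV.Beta.D1BFx.GluonLocalDipRow (exists_locDip_row_le)
open Summit.QuantumFields.BalabanUV.Beta.D1BFx.GluonProjLocalRow (exists_projLoc_row_le)
open Summit.QuantumFields.BalabanUV.Beta.D1BFx.GluonNdlLocalRow (exists_ndlLoc_row_le)

variable {a N cgh₀ : ℝ} {cE cR cK cQ ωgl cgh : ℕ → ℝ}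

/-! ## §1 The ray pins against the auxiliary constant weight -/

/-- [folklore] `0 ≤ cgh₀` from the displayed scalar letter. -/
theorem zero_le_cgh₀ (hcgh : ∀ n : ℕ, |cgh n| ≤ cgh₀) : 0 ≤ cgh₀ := (abs_nonneg _).trans (hcgh 0)

/-- [folklore] the stencil weight of the needle piece at the ray: `|cQ n| ≤ cgh₀·a` (`a > 0`). -/
theorem abs_cQ_le (ha : 0 < a) (hcgh : ∀ n : ℕ, |cgh n| ≤ cgh₀) (hQ : ∀ n : ℕ, cQ n = cgh n * a) (n : ℕ) : |cQ n| ≤ cgh₀ * a := by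
  rw [hQ, abs_mul, abs_of_pos ha]
  exact mul_le_mul_of_nonneg_right (hcgh n) ha.le

/-- [folklore] **THE TRUE WEIGHT AGAINST THE AUXILIARY CONSTANT WEIGHT**: `|cK n·S| ≤ |cgh₀·n²·S|` at the ray `cK n = cgh n·n²`, `|cgh n| ≤ cgh₀`. -/
theorem abs_weight_cell_le (hcgh : ∀ n : ℕ, |cgh n| ≤ cgh₀) (hK : ∀ n : ℕ, cK n = cgh n * (n : ℝ) ^ 2) (n : ℕ) (S : ℝ) :
    |cK n * S| ≤ |cgh₀ * (n : ℝ) ^ 2 * S| := by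
  have h0 := zero_le_cgh₀ hcgh
  rw [hK, abs_mul, abs_mul, abs_mul, abs_mul, abs_of_nonneg h0, abs_of_nonneg (by positivity : (0 : ℝ) ≤ (n : ℝ) ^ 2)]
  exact mul_le_mul_of_nonneg_right (mul_le_mul_of_nonneg_right (hcgh n) (by positivity)) (abs_nonneg _)

/-! ## §2 The row T₁ -/

/-- [folklore] **«GN-WIRE ∕ T₁»: THE GLUON NEEDLE TABLE ROW `h₁` AT THE RAY OF RECORD**, modulo [B5, Prop. 1.2] ∧ [B5, (1.126)–(1.127)] BY NAME, the END's pins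
`hlam`, `cE = n⁴`, `cR = −cE`, the ray `cK n = cgh n·n²`, `cQ n = cgh n·a` and the displayed scalar letter `|cgh n| ≤ cgh₀` — NO cell hypothesis:
`∃ C₁ ≥ 0, ∀ n ≥ 2, |ωgl n·cE n·Σ_{b ∈ image resSite} n⁻⁴·(n⁻⁸·fullSum (w ↦ w_μw_ν·biBubbleTable Ga Ga SbT SbRc μ ν (b+w) b))| ≤ C₁` (`C₁ = 2N²·(C_d + C_n + C_p)`). -/
theorem h₁_of_prop12 (ha : 0 < a) (h12 : B5.Prop12Printed (fam nOf hn1 MOf a ha)) (h126 : B5.Kernel126_127Printed (kfam nOf MOf))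
    (hlam : ∀ n : ℕ, 2 ≤ n → ωgl n * cE n ^ 2 = 2 * N ^ 2 * (n : ℝ) ^ 8) (hcE : ∀ n : ℕ, 2 ≤ n → cE n = (n : ℝ) ^ 4)
    (hR : ∀ n : ℕ, 2 ≤ n → cR n = -cE n) (hcgh : ∀ n : ℕ, |cgh n| ≤ cgh₀) (hK : ∀ n : ℕ, cK n = cgh n * (n : ℝ) ^ 2)
    (hQ : ∀ n : ℕ, cQ n = cgh n * a) (μ ν : Fin 4) :
    ∃ C₁ : ℝ, 0 ≤ C₁ ∧ ∀ n : ℕ, 2 ≤ n → ∀ [NeZero n], |ωgl n * cE n * ∑ b ∈ (univ : Finset (Fin 4 → Fin n)).image resSite, ((n : ℝ) ^ 4)⁻¹ * (((n : ℝ) ^ 8)⁻¹ *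
      fullSum (fun w : Pt => toReal w μ * toReal w ν *
        biBubbleTable (Ga n a) (Ga n a) SbT (SbRc n a (cE n) (cR n) (cK n) (cQ n)) μ ν (b + w) b))| ≤ C₁ := by
  have hGa : ∀ n : ℕ, 2 ≤ n → ∀ [NeZero n], Spr (Ga n a) := fun n _ _ => spr_Ga_of_prop12 (a := a) (ha := ha) h12 h126 n
  obtain ⟨Cd, hCd, hd⟩ := exists_locDip_row_le a ha h12 h126 (cK := fun n => cgh₀ * (n : ℝ) ^ 2) (cgh := cgh₀) (fun _ => rfl) μ ν
  obtain ⟨Cn, hCn, hnd⟩ := exists_locNdl_row_le (a := a) ha h12 h126 (cQ := cQ) (cQ₀ := cgh₀ * a) (abs_cQ_le ha hcgh hQ) μ ν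
  obtain ⟨Cp, hCp, hp⟩ := exists_locProj_row_le a ha h12 h126 μ ν
  refine ⟨2 * N ^ 2 * (Cd + Cn + Cp), by positivity, ?_⟩
  refine h₁_of_pieces (cK := cK) (cQ := cQ) ha hGa hlam hcE hR μ ν (fun n _ _ => ?_) (fun n _ _ => hnd n) (fun n _ _ => hp n)
  exact (abs_weight_cell_le hcgh hK n _).trans (hd n)

/-! ## §3 The row T₂, modulo the T₂-K cell -/

/-- [folklore] **«GN-WIRE ∕ T₂»: THE GLUON NEEDLE TABLE ROW `h₂` AT THE RAY OF RECORD**, modulo [B5, Prop. 1.2] ∧ [B5, (1.126)–(1.127)] BY NAME, the pins and the ray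
as in `h₁_of_prop12`, and ONE displayed cell: the `dip ⊗ SbT` piece of T₂ at the auxiliary constant weight,
`hT₂K : ∃ C ≥ 0, ∀ n ≥ 1, |cgh₀·n²·cellSum n a (dipPiece n a) SbT μ ν| ≤ C` (claimable «T₂-K»; every announced shape instantiates it):
`∃ C₂ ≥ 0, ∀ n ≥ 2, |ωgl n·cE n·Σ_b n⁻⁴·(n⁻⁸·fullSum (w ↦ w_μw_ν·biBubbleTable Ga Ga SbRc SbT μ ν (b+w) b))| ≤ C₂`. -/
theorem h₂_of_prop12 (ha : 0 < a) (h12 : B5.Prop12Printed (fam nOf hn1 MOf a ha)) (h126 : B5.Kernel126_127Printed (kfam nOf MOf))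
    (hlam : ∀ n : ℕ, 2 ≤ n → ωgl n * cE n ^ 2 = 2 * N ^ 2 * (n : ℝ) ^ 8) (hcE : ∀ n : ℕ, 2 ≤ n → cE n = (n : ℝ) ^ 4)
    (hR : ∀ n : ℕ, 2 ≤ n → cR n = -cE n) (hcgh : ∀ n : ℕ, |cgh n| ≤ cgh₀) (hK : ∀ n : ℕ, cK n = cgh n * (n : ℝ) ^ 2)
    (hQ : ∀ n : ℕ, cQ n = cgh n * a)
    (μ ν : Fin 4)
    (hT₂K : ∃ C : ℝ, 0 ≤ C ∧ ∀ (n : ℕ) [NeZero n], |cgh₀ * (n : ℝ) ^ 2 * cellSum n a (dipPiece n a) SbT μ ν| ≤ C) :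
    ∃ C₂ : ℝ, 0 ≤ C₂ ∧ ∀ n : ℕ, 2 ≤ n → ∀ [NeZero n], |ωgl n * cE n * ∑ b ∈ (univ : Finset (Fin 4 → Fin n)).image resSite, ((n : ℝ) ^ 4)⁻¹ * (((n : ℝ) ^ 8)⁻¹ *
      fullSum (fun w : Pt => toReal w μ * toReal w ν *
        biBubbleTable (Ga n a) (Ga n a) (SbRc n a (cE n) (cR n) (cK n) (cQ n)) SbT μ ν (b + w) b))| ≤ C₂ := by
  have hGa : ∀ n : ℕ, 2 ≤ n → ∀ [NeZero n], Spr (Ga n a) := fun n _ _ => spr_Ga_of_prop12 (a := a) (ha := ha) h12 h126 n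
  obtain ⟨Cd, hCd, hd⟩ := hT₂K
  obtain ⟨Cn, hCn, hnd⟩ := exists_ndlLoc_row_le (a := a) ha h12 h126 (cQ := cQ) (cQ₀ := cgh₀ * a) (abs_cQ_le ha hcgh hQ) μ ν
  obtain ⟨Cp, hCp, hp⟩ := exists_projLoc_row_le a ha h12 h126 μ ν
  refine ⟨2 * N ^ 2 * (Cd + Cn + Cp), by positivity, ?_⟩
  refine h₂_of_pieces (cK := cK) (cQ := cQ) ha hGa hlam hcE hR μ ν (fun n _ _ => ?_) (fun n _ _ => hnd n) (fun n _ _ => hp n)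
  exact (abs_weight_cell_le hcgh hK n _).trans (hd n)

/-! ## §4 (v1.1, APPENDED 2026-08-21 after leaf-03-g13's «T₂-K» `GluonDipLocalRow` p275613 landed) The row T₂ with NO cell hypothesis -/

open Summit.QuantumFields.BalabanUV.Beta.D1BFx.GluonDipLocalRow (exists_dipLoc_row_le) in
/-- [folklore] **«GN-WIRE ∕ T₂» CLOSED AT THE RAY: THE GLUON NEEDLE TABLE ROW `h₂` WITH NO CELL HYPOTHESIS** — `h₂_of_prop12` with its displayed cell `hT₂K`
discharged by leaf-03-g13's `GluonDipLocalRow.exists_dipLoc_row_le` (the `dip ⊗ SbT` piece by «CELLSUM-TRANSPOSE» from the T₁ piece) at the CONSTANT auxiliary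
weight `cgh₀·n²` (its equality pin met by `rfl`).  Displayed: h12∕h126, `hlam`, `cE = n⁴`, `cR = −cE`, the ray `hK`∕`hQ` with `|cgh n| ≤ cgh₀` (P13). -/
theorem h₂_of_prop12' (ha : 0 < a) (h12 : B5.Prop12Printed (fam nOf hn1 MOf a ha)) (h126 : B5.Kernel126_127Printed (kfam nOf MOf))
    (hlam : ∀ n : ℕ, 2 ≤ n → ωgl n * cE n ^ 2 = 2 * N ^ 2 * (n : ℝ) ^ 8) (hcE : ∀ n : ℕ, 2 ≤ n → cE n = (n : ℝ) ^ 4)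
    (hR : ∀ n : ℕ, 2 ≤ n → cR n = -cE n) (hcgh : ∀ n : ℕ, |cgh n| ≤ cgh₀) (hK : ∀ n : ℕ, cK n = cgh n * (n : ℝ) ^ 2)
    (hQ : ∀ n : ℕ, cQ n = cgh n * a) (μ ν : Fin 4) :
    ∃ C₂ : ℝ, 0 ≤ C₂ ∧ ∀ n : ℕ, 2 ≤ n → ∀ [NeZero n], |ωgl n * cE n * ∑ b ∈ (univ : Finset (Fin 4 → Fin n)).image resSite, ((n : ℝ) ^ 4)⁻¹ * (((n : ℝ) ^ 8)⁻¹ *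
      fullSum (fun w : Pt => toReal w μ * toReal w ν *
        biBubbleTable (Ga n a) (Ga n a) (SbRc n a (cE n) (cR n) (cK n) (cQ n)) SbT μ ν (b + w) b))| ≤ C₂ :=
  h₂_of_prop12 ha h12 h126 hlam hcE hR hcgh hK hQ μ ν
    (exists_dipLoc_row_le a ha h12 h126 (cK := fun n => cgh₀ * (n : ℝ) ^ 2) (cgh := cgh₀) (fun _ => rfl) μ ν)

end Summit.QuantumFields.BalabanUV.Beta.D1BFx.GluonNeedleRowsT12

end
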